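import Summits.Ventures.Crystal3D.Theorems.StickyWulffConstantGenericWallFloorTopCredits
import Summits.Ventures.Crystal3D.Theorems.StickyWulffConstantGenericWallFloorSharedTriangle
import HarnessLib

/-!
# Where exits live: a full-shell ball deep inside a clamped slab is a grain ball with all its neighbours on the grain

HONEST FRAMING. Part of the venture `Summits/Ventures/Crystal3D` (cell `crystal3d-full`), helper for the
crux `GenericWallFloor` (stmt-Ventures-19480) of `route-Ventures-StickyWulffConstant`, REGISTERED line
`WallLedgerG` (planner cf-p1 gen 16), stub `stub_twoSlabAdhesion : TwoSlabAdhesion` (THE CRUX of the line).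
Bookkeeping for the two-grain general-filling ledger: the «exits» of the grains (`card_exits_ge`,
`exit_trichotomy`, `card_exits_le`) live OUTSIDE the cores of the clamped slabs.  Rung credit only; F-C1
not moved.

* `frame_slots_subset_of_full_shell_bottom` — if a ball `d ∈ X` with its full `B`-shell
  (`d + B w ∈ X`, all slots) sits deep inside the bottom clamped slab of `Λ = A·Λ₀ + t` (height
  `≤ −R₀ − 2`, non-rim), then every slot vector `B w` lies in the linear lattice `A·Λ₀` (all thirteen
  balls are grain balls, by sealing `mem_sample_of_mem_core` and the clean sliver).  For `B = A₂ ≠` frame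
  of `Λ` this is absurd — no exit of the OTHER grain is born there.
* `slots_mem_of_full_shell_bottom` — for the grain's own frame `B = A` and a steep up-slot `u`: the
  successor `d + A u` has ALL its slots occupied — no exit of the grain itself is born there either.
* `…_top` — the mirror statements for the top clamped slab.

WHAT THIS IS NOT: no new mathematics; F-C1 not moved.
-/

noncomputable section

namespace Summit.Ventures.Crystal3D.Theorems

open Summit.Ventures.Crystal3D Finset
open Literature.MathematicalPhysics.StatisticalMechanics (fccStacking barlowStacking constHagg)
open scoped InnerProductSpace

/-- Lateral radius of `x + v` with `‖v‖ ≤ k`... squared form: `lat(x) ≤ (r)²`, `0 ≤ r` ⇒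
`lat(x + v) ≤ (r + ‖v‖)²`. -/
theorem lateral_sq_add_le (x v : EuclideanSpace ℝ (Fin 3)) {r : ℝ} (hr : 0 ≤ r)
    (hx : x 0 ^ 2 + x 1 ^ 2 ≤ r ^ 2) : (x + v) 0 ^ 2 + (x + v) 1 ^ 2 ≤ (r + ‖v‖) ^ 2 := by
  have h1 := sqrt_lateral_add_le x v
  have hsx : Real.sqrt (x 0 ^ 2 + x 1 ^ 2) ≤ r := by
    rw [← Real.sqrt_sq hr]; exact Real.sqrt_le_sqrt hx
  have h3 := Real.sq_sqrt (by positivity : (0 : ℝ) ≤ (x + v) 0 ^ 2 + (x + v) 1 ^ 2)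
  have h4 : (0 : ℝ) ≤ Real.sqrt ((x + v) 0 ^ 2 + (x + v) 1 ^ 2) := Real.sqrt_nonneg _
  have h5 : Real.sqrt ((x + v) 0 ^ 2 + (x + v) 1 ^ 2) ≤ r + ‖v‖ := by linarith
  have h6 : (0 : ℝ) ≤ r + ‖v‖ := by positivity
  nlinarith

/-- A ball of `X` deep inside the bottom clamped slab region is a ball of the sample. -/
theorem mem_sample_bottom_of_deep
    (A : EuclideanSpace ℝ (Fin 3) ≃ₗᵢ[ℝ] EuclideanSpace ℝ (Fin 3)) (t : EuclideanSpace ℝ (Fin 3))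
    (X P : Finset (EuclideanSpace ℝ (Fin 3))) (R₀ ρ : ℝ) (hR₀ : 3 ≤ R₀) (hρ : R₀ ≤ ρ)
    (hX : ∀ p ∈ X, ∀ q ∈ X, p ≠ q → 1 ≤ dist p q) (hPX : P ⊆ X)
    (hcell : ∀ p ∈ X, -(2 * R₀) ≤ p 2)
    (hP : ∀ p, p ∈ P ↔ (p ∈ (fun q => A q + t) '' fccStacking 1 (Real.sqrt (2 / 3)) ∧
      -(2 * R₀) ≤ p 2 ∧ p 2 ≤ -R₀ ∧ p 0 ^ 2 + p 1 ^ 2 ≤ ρ ^ 2))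
    (hclean : ∀ p ∈ X, p 2 < -(2 * R₀) + 1 → p ∈ (fun q => A q + t) '' fccStacking 1 (Real.sqrt (2 / 3)))
    {q : EuclideanSpace ℝ (Fin 3)} (hq : q ∈ X) (hq2 : q 2 ≤ -R₀ - 1) (hqr : q 0 ^ 2 + q 1 ^ 2 ≤ (ρ - 1) ^ 2) :
    q ∈ P := by
  have hρ1 : (1 : ℝ) ≤ ρ := by linarith
  by_cases hlow : q 2 < -(2 * R₀) + 1
  · rw [hP]
    have hρ0 : (0 : ℝ) ≤ ρ - 1 := by linarith
    exact ⟨hclean q hq hlow, hcell q hq, by linarith, by nlinarith⟩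
  · push Not at hlow
    have hPimp : ∀ p : EuclideanSpace ℝ (Fin 3),
        p ∈ (fun y => A y + t) '' barlowStacking 1 (Real.sqrt (2 / 3)) constHagg →
        -(2 * R₀) ≤ p 2 → p 2 ≤ -R₀ → p 0 ^ 2 + p 1 ^ 2 ≤ ρ ^ 2 → p ∈ P :=
      fun p hp h1 h2 h3 => (hP p).2 ⟨hp, h1, h2, h3⟩
    exact mem_sample_of_mem_core constHagg A t X P (-(2 * R₀)) (-R₀) ρ hρ1 hPX hX hPimp q hq
      hlow (by linarith) hqr

/-- A ball of `X` deep inside the TOP clamped slab region is a ball of the top sample. -/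
theorem mem_sample_top_of_deep
    (A : EuclideanSpace ℝ (Fin 3) ≃ₗᵢ[ℝ] EuclideanSpace ℝ (Fin 3)) (t : EuclideanSpace ℝ (Fin 3))
    (X P : Finset (EuclideanSpace ℝ (Fin 3))) (R₀ h ρ : ℝ) (hR₀ : 3 ≤ R₀) (hρ : R₀ ≤ ρ)
    (hX : ∀ p ∈ X, ∀ q ∈ X, p ≠ q → 1 ≤ dist p q) (hPX : P ⊆ X)
    (hcell : ∀ p ∈ X, p 2 ≤ h + 2 * R₀)
    (hP : ∀ p, p ∈ P ↔ (p ∈ (fun q => A q + t) '' fccStacking 1 (Real.sqrt (2 / 3)) ∧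
      h + R₀ ≤ p 2 ∧ p 2 ≤ h + 2 * R₀ ∧ p 0 ^ 2 + p 1 ^ 2 ≤ ρ ^ 2))
    (hclean : ∀ p ∈ X, h + 2 * R₀ - 1 < p 2 → p ∈ (fun q => A q + t) '' fccStacking 1 (Real.sqrt (2 / 3)))
    {q : EuclideanSpace ℝ (Fin 3)} (hq : q ∈ X) (hq2 : h + R₀ + 1 ≤ q 2) (hqr : q 0 ^ 2 + q 1 ^ 2 ≤ (ρ - 1) ^ 2) :
    q ∈ P := by
  have hρ1 : (1 : ℝ) ≤ ρ := by linarith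
  by_cases hhigh : h + 2 * R₀ - 1 < q 2
  · rw [hP]
    have hρ0 : (0 : ℝ) ≤ ρ - 1 := by linarith
    exact ⟨hclean q hq hhigh, by linarith, hcell q hq, by nlinarith⟩
  · push Not at hhigh
    have hPimp : ∀ p : EuclideanSpace ℝ (Fin 3),
        p ∈ (fun y => A y + t) '' barlowStacking 1 (Real.sqrt (2 / 3)) constHagg →
        h + R₀ ≤ p 2 → p 2 ≤ h + 2 * R₀ → p 0 ^ 2 + p 1 ^ 2 ≤ ρ ^ 2 → p ∈ P :=
      fun p hp h1 h2 h3 => (hP p).2 ⟨hp, h1, h2, h3⟩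
    exact mem_sample_of_mem_core constHagg A t X P (h + R₀) (h + 2 * R₀) ρ hρ1 hPX hX hPimp q hq
      hq2 (by linarith) hqr

/-- **A full `B`-shell deep in the bottom slab puts all slot vectors of `B` in the grain's linear lattice.** -/
theorem frame_slots_subset_of_full_shell_bottom
    (A : EuclideanSpace ℝ (Fin 3) ≃ₗᵢ[ℝ] EuclideanSpace ℝ (Fin 3)) (t : EuclideanSpace ℝ (Fin 3))
    (X P : Finset (EuclideanSpace ℝ (Fin 3))) (R₀ ρ : ℝ) (hR₀ : 3 ≤ R₀) (hρ : R₀ ≤ ρ)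
    (hX : ∀ p ∈ X, ∀ q ∈ X, p ≠ q → 1 ≤ dist p q) (hPX : P ⊆ X)
    (hcell : ∀ p ∈ X, -(2 * R₀) ≤ p 2)
    (hP : ∀ p, p ∈ P ↔ (p ∈ (fun q => A q + t) '' fccStacking 1 (Real.sqrt (2 / 3)) ∧
      -(2 * R₀) ≤ p 2 ∧ p 2 ≤ -R₀ ∧ p 0 ^ 2 + p 1 ^ 2 ≤ ρ ^ 2))
    (hclean : ∀ p ∈ X, p 2 < -(2 * R₀) + 1 → p ∈ (fun q => A q + t) '' fccStacking 1 (Real.sqrt (2 / 3)))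
    (B : EuclideanSpace ℝ (Fin 3) ≃ₗᵢ[ℝ] EuclideanSpace ℝ (Fin 3)) {d : EuclideanSpace ℝ (Fin 3)}
    (hd : d ∈ X) (hfull : ∀ w ∈ fccSlots, d + B w ∈ X) (hd2 : d 2 ≤ -R₀ - 2)
    (hdr : d 0 ^ 2 + d 1 ^ 2 ≤ (ρ - 2) ^ 2) :
    ∀ w ∈ fccSlots, B w ∈ A '' fccStacking 1 (Real.sqrt (2 / 3)) := by
  intro w hw
  have hw1 : ‖B w‖ = 1 := by rw [LinearIsometryEquiv.norm_map, norm_eq_one_of_mem_fccSlots hw]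
  have hρ2 : (0 : ℝ) ≤ ρ - 2 := by linarith
  have hdP : d ∈ P := mem_sample_bottom_of_deep A t X P R₀ ρ hR₀ hρ hX hPX hcell hP hclean hd (by linarith)
    (by nlinarith)
  have h2 : (d + B w) 2 = d 2 + ⟪B w, EuclideanSpace.single (2 : Fin 3) (1 : ℝ)⟫_ℝ := by
    rw [PiLp.add_apply, apply_two_eq_inner_e₃ (B w)]
  have hα := (abs_le.1 (abs_inner_slot_le_one B hw)).2
  have hlat : (d + B w) 0 ^ 2 + (d + B w) 1 ^ 2 ≤ (ρ - 1) ^ 2 := by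
    have := lateral_sq_add_le d (B w) hρ2 hdr
    rw [hw1, show ρ - 2 + 1 = ρ - 1 by ring] at this
    exact this
  have hqP : d + B w ∈ P := mem_sample_bottom_of_deep A t X P R₀ ρ hR₀ hρ hX hPX hcell hP hclean
    (hfull w hw) (by rw [h2]; linarith) hlat
  have e : B w = (d + B w) - d := by abel
  rw [e]
  exact sub_mem_image_of_mem_affine A t _ _ ((hP _).1 hqP).1 ((hP _).1 hdP).1

/-- **Mirror statement for the top slab.** -/
theorem frame_slots_subset_of_full_shell_top
    (A : EuclideanSpace ℝ (Fin 3) ≃ₗᵢ[ℝ] EuclideanSpace ℝ (Fin 3)) (t : EuclideanSpace ℝ (Fin 3))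
    (X P : Finset (EuclideanSpace ℝ (Fin 3))) (R₀ h ρ : ℝ) (hR₀ : 3 ≤ R₀) (hρ : R₀ ≤ ρ)
    (hX : ∀ p ∈ X, ∀ q ∈ X, p ≠ q → 1 ≤ dist p q) (hPX : P ⊆ X)
    (hcell : ∀ p ∈ X, p 2 ≤ h + 2 * R₀)
    (hP : ∀ p, p ∈ P ↔ (p ∈ (fun q => A q + t) '' fccStacking 1 (Real.sqrt (2 / 3)) ∧
      h + R₀ ≤ p 2 ∧ p 2 ≤ h + 2 * R₀ ∧ p 0 ^ 2 + p 1 ^ 2 ≤ ρ ^ 2))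
    (hclean : ∀ p ∈ X, h + 2 * R₀ - 1 < p 2 → p ∈ (fun q => A q + t) '' fccStacking 1 (Real.sqrt (2 / 3)))
    (B : EuclideanSpace ℝ (Fin 3) ≃ₗᵢ[ℝ] EuclideanSpace ℝ (Fin 3)) {d : EuclideanSpace ℝ (Fin 3)}
    (hd : d ∈ X) (hfull : ∀ w ∈ fccSlots, d + B w ∈ X) (hd2 : h + R₀ + 2 ≤ d 2)
    (hdr : d 0 ^ 2 + d 1 ^ 2 ≤ (ρ - 2) ^ 2) :
    ∀ w ∈ fccSlots, B w ∈ A '' fccStacking 1 (Real.sqrt (2 / 3)) := by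
  intro w hw
  have hw1 : ‖B w‖ = 1 := by rw [LinearIsometryEquiv.norm_map, norm_eq_one_of_mem_fccSlots hw]
  have hρ2 : (0 : ℝ) ≤ ρ - 2 := by linarith
  have hdP : d ∈ P := mem_sample_top_of_deep A t X P R₀ h ρ hR₀ hρ hX hPX hcell hP hclean hd (by linarith)
    (by nlinarith)
  have h2 : (d + B w) 2 = d 2 + ⟪B w, EuclideanSpace.single (2 : Fin 3) (1 : ℝ)⟫_ℝ := by
    rw [PiLp.add_apply, apply_two_eq_inner_e₃ (B w)]
  have hα := (abs_le.1 (abs_inner_slot_le_one B hw)).1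
  have hlat : (d + B w) 0 ^ 2 + (d + B w) 1 ^ 2 ≤ (ρ - 1) ^ 2 := by
    have := lateral_sq_add_le d (B w) hρ2 hdr
    rw [hw1, show ρ - 2 + 1 = ρ - 1 by ring] at this
    exact this
  have hqP : d + B w ∈ P := mem_sample_top_of_deep A t X P R₀ h ρ hR₀ hρ hX hPX hcell hP hclean
    (hfull w hw) (by rw [h2]; linarith) hlat
  have e : B w = (d + B w) - d := by abel
  rw [e]
  exact sub_mem_image_of_mem_affine A t _ _ ((hP _).1 hqP).1 ((hP _).1 hdP).1

/-- **The grain's own exits are not born deep in the bottom slab.**  If `d ∈ X` with full `A`-shell sits at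
height `≤ −R₀ − 3` off the rim and `u` is a steep up-slot, then for every slot `v` the site `d + A u + A v`
carries a ball of `X` (it is a site of the complete sample) — so `d + A u` is never an exit. -/
theorem slot_mem_of_full_shell_bottom
    (A : EuclideanSpace ℝ (Fin 3) ≃ₗᵢ[ℝ] EuclideanSpace ℝ (Fin 3)) (t : EuclideanSpace ℝ (Fin 3))
    (X P : Finset (EuclideanSpace ℝ (Fin 3))) (R₀ ρ : ℝ) (hR₀ : 3 ≤ R₀) (hρ : R₀ ≤ ρ)
    (hX : ∀ p ∈ X, ∀ q ∈ X, p ≠ q → 1 ≤ dist p q) (hPX : P ⊆ X)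
    (hcell : ∀ p ∈ X, -(2 * R₀) ≤ p 2)
    (hP : ∀ p, p ∈ P ↔ (p ∈ (fun q => A q + t) '' fccStacking 1 (Real.sqrt (2 / 3)) ∧
      -(2 * R₀) ≤ p 2 ∧ p 2 ≤ -R₀ ∧ p 0 ^ 2 + p 1 ^ 2 ≤ ρ ^ 2))
    (hclean : ∀ p ∈ X, p 2 < -(2 * R₀) + 1 → p ∈ (fun q => A q + t) '' fccStacking 1 (Real.sqrt (2 / 3)))
    {d : EuclideanSpace ℝ (Fin 3)} (hd : d ∈ X) (hfull : ∀ w ∈ fccSlots, d + A w ∈ X) (hd2 : d 2 ≤ -R₀ - 3)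
    (hdr : d 0 ^ 2 + d 1 ^ 2 ≤ (ρ - 2) ^ 2) {u v : EuclideanSpace ℝ (Fin 3)} (hu : u ∈ fccSlots)
    (hsteep : Real.sqrt 2 / 2 ≤ ⟪A u, EuclideanSpace.single (2 : Fin 3) (1 : ℝ)⟫_ℝ) (hv : v ∈ fccSlots) :
    d + A u + A v ∈ X := by
  have hρ2 : (0 : ℝ) ≤ ρ - 2 := by linarith
  have hdP : d ∈ P := mem_sample_bottom_of_deep A t X P R₀ ρ hR₀ hρ hX hPX hcell hP hclean hd (by linarith)
    (by nlinarith)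
  have hdΛ := ((hP d).1 hdP).1
  -- lower bound on the height of `d`: the ball `d − A u` of its shell stays in the cell
  have hs2 : (1 : ℝ) < Real.sqrt 2 := by
    rw [show (1 : ℝ) = Real.sqrt 1 by rw [Real.sqrt_one]]
    exact Real.sqrt_lt_sqrt (by norm_num) (by norm_num)
  have hlow : -(2 * R₀) + Real.sqrt 2 / 2 ≤ d 2 := by
    have hmem := hfull (-u) (neg_mem_fccSlots hu)
    have h2 : (d + A (-u)) 2 = d 2 - ⟪A u, EuclideanSpace.single (2 : Fin 3) (1 : ℝ)⟫_ℝ := by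
      rw [PiLp.add_apply, apply_two_eq_inner_e₃ (A (-u)), map_neg, inner_neg_left]; ring
    have := hcell _ hmem
    rw [h2] at this; linarith
  have hαu := abs_le.1 (abs_inner_slot_le_one A hu)
  have hαv := abs_le.1 (abs_inner_slot_le_one A hv)
  have h2 : (d + A u + A v) 2 = d 2 + ⟪A u, EuclideanSpace.single (2 : Fin 3) (1 : ℝ)⟫_ℝ +
      ⟪A v, EuclideanSpace.single (2 : Fin 3) (1 : ℝ)⟫_ℝ := by
    rw [PiLp.add_apply, PiLp.add_apply, apply_two_eq_inner_e₃ (A u), apply_two_eq_inner_e₃ (A v)]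
  have hlat : (d + A u + A v) 0 ^ 2 + (d + A u + A v) 1 ^ 2 ≤ ρ ^ 2 := by
    have h1 := lateral_sq_add_le d (A u) hρ2 hdr
    rw [LinearIsometryEquiv.norm_map, norm_eq_one_of_mem_fccSlots hu, show ρ - 2 + 1 = ρ - 1 by ring] at h1
    have h3 := lateral_sq_add_le (d + A u) (A v) (by linarith) h1
    rw [LinearIsometryEquiv.norm_map, norm_eq_one_of_mem_fccSlots hv, show ρ - 1 + 1 = ρ by ring] at h3
    exact h3
  refine hPX ((hP _).2 ⟨?_, by rw [h2]; linarith, by rw [h2]; linarith, hlat⟩)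
  exact movedFcc_add_site_mem A t (movedFcc_add_site_mem A t hdΛ (mem_fcc_of_mem_fccSlots hu))
    (mem_fcc_of_mem_fccSlots hv)

/-- **Mirror statement for the top slab** (steep DOWN-slot `u`). -/
theorem slot_mem_of_full_shell_top
    (A : EuclideanSpace ℝ (Fin 3) ≃ₗᵢ[ℝ] EuclideanSpace ℝ (Fin 3)) (t : EuclideanSpace ℝ (Fin 3))
    (X P : Finset (EuclideanSpace ℝ (Fin 3))) (R₀ h ρ : ℝ) (hR₀ : 3 ≤ R₀) (hρ : R₀ ≤ ρ)
    (hX : ∀ p ∈ X, ∀ q ∈ X, p ≠ q → 1 ≤ dist p q) (hPX : P ⊆ X)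
    (hcell : ∀ p ∈ X, p 2 ≤ h + 2 * R₀)
    (hP : ∀ p, p ∈ P ↔ (p ∈ (fun q => A q + t) '' fccStacking 1 (Real.sqrt (2 / 3)) ∧
      h + R₀ ≤ p 2 ∧ p 2 ≤ h + 2 * R₀ ∧ p 0 ^ 2 + p 1 ^ 2 ≤ ρ ^ 2))
    (hclean : ∀ p ∈ X, h + 2 * R₀ - 1 < p 2 → p ∈ (fun q => A q + t) '' fccStacking 1 (Real.sqrt (2 / 3)))
    {d : EuclideanSpace ℝ (Fin 3)} (hd : d ∈ X) (hfull : ∀ w ∈ fccSlots, d + A w ∈ X) (hd2 : h + R₀ + 3 ≤ d 2)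
    (hdr : d 0 ^ 2 + d 1 ^ 2 ≤ (ρ - 2) ^ 2) {u v : EuclideanSpace ℝ (Fin 3)} (hu : u ∈ fccSlots)
    (hsteep : ⟪A u, EuclideanSpace.single (2 : Fin 3) (1 : ℝ)⟫_ℝ ≤ -(Real.sqrt 2 / 2)) (hv : v ∈ fccSlots) :
    d + A u + A v ∈ X := by
  have hρ2 : (0 : ℝ) ≤ ρ - 2 := by linarith
  have hdP : d ∈ P := mem_sample_top_of_deep A t X P R₀ h ρ hR₀ hρ hX hPX hcell hP hclean hd (by linarith)
    (by nlinarith)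
  have hdΛ := ((hP d).1 hdP).1
  have hs2 : (1 : ℝ) < Real.sqrt 2 := by
    rw [show (1 : ℝ) = Real.sqrt 1 by rw [Real.sqrt_one]]
    exact Real.sqrt_lt_sqrt (by norm_num) (by norm_num)
  have hhigh : d 2 ≤ h + 2 * R₀ - Real.sqrt 2 / 2 := by
    have hmem := hfull (-u) (neg_mem_fccSlots hu)
    have h2 : (d + A (-u)) 2 = d 2 - ⟪A u, EuclideanSpace.single (2 : Fin 3) (1 : ℝ)⟫_ℝ := by
      rw [PiLp.add_apply, apply_two_eq_inner_e₃ (A (-u)), map_neg, inner_neg_left]; ring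
    have := hcell _ hmem
    rw [h2] at this; linarith
  have hαu := abs_le.1 (abs_inner_slot_le_one A hu)
  have hαv := abs_le.1 (abs_inner_slot_le_one A hv)
  have h2 : (d + A u + A v) 2 = d 2 + ⟪A u, EuclideanSpace.single (2 : Fin 3) (1 : ℝ)⟫_ℝ +
      ⟪A v, EuclideanSpace.single (2 : Fin 3) (1 : ℝ)⟫_ℝ := by
    rw [PiLp.add_apply, PiLp.add_apply, apply_two_eq_inner_e₃ (A u), apply_two_eq_inner_e₃ (A v)]
  have hlat : (d + A u + A v) 0 ^ 2 + (d + A u + A v) 1 ^ 2 ≤ ρ ^ 2 := by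
    have h1 := lateral_sq_add_le d (A u) hρ2 hdr
    rw [LinearIsometryEquiv.norm_map, norm_eq_one_of_mem_fccSlots hu, show ρ - 2 + 1 = ρ - 1 by ring] at h1
    have h3 := lateral_sq_add_le (d + A u) (A v) (by linarith) h1
    rw [LinearIsometryEquiv.norm_map, norm_eq_one_of_mem_fccSlots hv, show ρ - 1 + 1 = ρ by ring] at h3
    exact h3
  refine hPX ((hP _).2 ⟨?_, by rw [h2]; linarith, by rw [h2]; linarith, hlat⟩)
  exact movedFcc_add_site_mem A t (movedFcc_add_site_mem A t hdΛ (mem_fcc_of_mem_fccSlots hu))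
    (mem_fcc_of_mem_fccSlots hv)

end Summit.Ventures.Crystal3D.Theorems

end
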